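import Literature.Analysis.FluidPDE.EnstrophyWeightSlab
import HarnessLib

/-!
# The energy balance of a linear image of the vorticity on a closed slab (Chae–Choe 1999, (12))

search for candidate a priori estimates; no regularity claim (cell `pub-nsfunc`, literature seat:
Analysis/FluidPDE proof file — theorems only: no definition, no named fact, no `sorry`).

Chae–Choe, *Regularity of solutions to the Navier–Stokes equation*, Electron. J. Differential
Equations 1999 No. 05, proof of Thm. 2: with `ω̃ = ω₁e₁ + ω₂e₂` the first two components of the
vorticity of a solution `v`, "taking the first two components of the vorticity equation (4), we
obtain `ω̃ₜ + (v·∇)ω̃ = (ω·∇)ṽ + νΔω̃`. Taking `L²(ℝ³)` inner product with `ω̃`, we have, after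
integration by part, `½ d/dt ‖ω̃(t)‖²₂ + ν‖∇ω̃(t)‖²₂ = ∫(ω·∇)ṽ·ω̃ dx` (12)", followed by Grönwall's
lemma with the weight `C‖∇ṽ‖_γ^{2γ/(γ−3)}` and the forcing `C‖ω‖²₂`.

This file proves the two analytic facts behind (12) and the Grönwall step, for the image
`P ω` of the vorticity under an ARBITRARY constant linear map `P : ℝ³ →L ℝ³` (for Chae–Choe,
`P` = the coordinate projection onto `span{e₁, e₂}`; the tree's users instantiate `P`):

* `integral_inner_clm_curl_eq_of_vorticity_eq` — **the fixed-time identity**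
  `∫⟪Pω, P∂ₜω⟫ = −ν ∫|∇(Pω)|²_F + ∫⟪Pω, P((∇v)ω)⟫` for a `C³` divergence-free bounded field
  with `∇v` bounded and `∇v, ∇²v, ∇³v ∈ L²`, `∂ₜω` given by the vorticity equation
  (`P` commutes with `Δ` and with `(v·∇)`; Green's identity and the skew-symmetry
  `∫⟪Pω, (v·∇)Pω⟫ = 0`; the `P = 1` case is the tree's `integral_inner_curl_eq_of_vorticity_eq`);
* `integral_sq_norm_clm_curl_le_of_weight_slab_ae` — **the slab Grönwall bound with an
  integrable weight and the enstrophy as forcing**: on a closed slab `[0, T'']` in the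
  Beale–Kato–Majda class, if for a.e. `t`
  `2∫⟪Pω, P((∇u)ω)⟫ ≤ ν∫|∇(Pω)|²_F + β∫|ω|² + a(t)∫|Pω|²` with `a ≥ 0`, `∫₀^{T''} a ≤ A`,
  `β ≥ 0` and `∫₀^{T''}∫|ω|² ≤ E₁`, then `∫|Pω(t)|² ≤ (∫|Pω(0)|² + βE₁)·exp A` on `[0, T'']`
  (the balance `IsSmoothSpaceTimeOn.l2_balance` for the smooth space–time field `Pω`, whose
  time derivative is `P∂ₜω`, and the tree's `lintegral_gronwall_le`).

Everything is stated in the vocabulary of `ConstantinFeffermanEnstrophySlab.lean` /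
`EnstrophyWeightSlab.lean` (classical solutions `IsClassicalNSSolutionOn (Icc 0 T'') ν 0 u p`,
`HasBoundedSobolevNormsOn`, `curl`, `convect`, `frobeniusNormSq`, `timeDerivWithin`).

## References

* D. Chae, H.-J. Choe, Electron. J. Differential Equations 1999 (1999), No. 05, 1–7: proof of
  Thm. 2, (12)–(13) and the Grönwall step (p. 5–6; open access, text read). [ChaeChoe1999]
* P. G. Lemarié-Rieusset, *The Navier–Stokes problem in the 21st century* (2016), §11.6,
  (11.60) (the vorticity energy identity). [LemarieRieusset2016]
-/

noncomputable section

open MeasureTheory Set Function Filter Metric Real InnerProductSpace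
open _root_.Topology
open scoped ENNReal NNReal RealInnerProductSpace ContDiff Laplacian

namespace Literature.Analysis.FluidPDE

-- nested operator types (second and third derivatives)
set_option maxSynthPendingDepth 3

/-- `ofReal (∫ f) ≤ ∫⁻ ofReal f` for every real function (junk value `0` if not integrable). [folklore] -/
private theorem ofReal_integral_le_lintegral_ofReal_tc {α : Type*} [MeasurableSpace α] {μ : Measure α}
    (f : α → ℝ) : ENNReal.ofReal (∫ x, f x ∂μ) ≤ ∫⁻ x, ENNReal.ofReal (f x) ∂μ := by
  by_cases hf : Integrable f μ
  · have hpos : Integrable (fun x => max (f x) 0) μ := hf.pos_part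
    have h1 : ∫ x, f x ∂μ ≤ ∫ x, max (f x) 0 ∂μ := integral_mono hf hpos fun x => le_max_left _ _
    have h2 : ENNReal.ofReal (∫ x, max (f x) 0 ∂μ) = ∫⁻ x, ENNReal.ofReal (max (f x) 0) ∂μ :=
      ofReal_integral_eq_lintegral_ofReal hpos (Eventually.of_forall fun x => le_max_right _ _)
    have h3 : ∫⁻ x, ENNReal.ofReal (max (f x) 0) ∂μ = ∫⁻ x, ENNReal.ofReal (f x) ∂μ := by
      refine lintegral_congr fun x => ?_
      rcases le_total (f x) 0 with h | h
      · rw [max_eq_right h, ENNReal.ofReal_of_nonpos h, ENNReal.ofReal_zero]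
      · rw [max_eq_left h]
    calc ENNReal.ofReal (∫ x, f x ∂μ) ≤ ENNReal.ofReal (∫ x, max (f x) 0 ∂μ) := ENNReal.ofReal_le_ofReal h1
      _ = ∫⁻ x, ENNReal.ofReal (f x) ∂μ := by rw [h2, h3]
  · rw [integral_undef hf, ENNReal.ofReal_zero]
    exact zero_le

/-! ### The fixed-time identity for `Pω` -/

set_option maxHeartbeats 1600000 in
/-- **The energy identity for a linear image of the vorticity** (Chae–Choe 1999, (12), at a fixed
time; Lemarié-Rieusset 2016, (11.60) composed with a constant linear map). Let `v ∈ C³(ℝ³; ℝ³)`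
be divergence free and bounded with `∇v` bounded and `∇v, ∇²v, ∇³v ∈ L²`, `ω = curl v`, let
`W` be a field with `W + (v·∇)ω = (ω·∇)v + νΔω` pointwise (the vorticity equation at a fixed
time, `W = ∂ₜω`), and let `P : ℝ³ →L ℝ³` be any constant linear map. Then
`∫⟪Pω, PW⟫ = −ν ∫|∇(Pω)|²_F + ∫⟪Pω, P((∇v)ω)⟫`: `P` commutes with `Δ` and with `(v·∇)`,
Green's identity `∫⟪Pω, Δ(Pω)⟫ = −∫|∇(Pω)|²_F`, and the skew-symmetry `∫⟪Pω, (v·∇)(Pω)⟫ = 0`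
(`div v = 0`, the tree's `integral_inner_weakGrad_apply_self_eq_zero`). For `P = 1` this is the
tree's `integral_inner_curl_eq_of_vorticity_eq`. [cite: ChaeChoe1999, proof of Thm. 2, (12) (p. 5); LemarieRieusset2016, §11.6 (11.60)] -/
theorem integral_inner_clm_curl_eq_of_vorticity_eq {ν : ℝ}
    (P : EuclideanSpace ℝ (Fin 3) →L[ℝ] EuclideanSpace ℝ (Fin 3))
    {v W : (EuclideanSpace ℝ (Fin 3)) → (EuclideanSpace ℝ (Fin 3))} (hv : ContDiff ℝ 3 v)
    (hdiv : VectorCalculus.IsDivFree v)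
    (heq : ∀ x, W x + convect v (curl v) x = convect (curl v) v x + ν • (Δ (curl v)) x)
    {B : ℝ} (hB : ∀ x, ‖v x‖ ≤ B) {B₁ : ℝ} (hB₁ : ∀ x, ‖fderiv ℝ v x‖ ≤ B₁)
    (h1 : ∫⁻ x, ‖iteratedFDeriv ℝ 1 v x‖ₑ ^ 2 < ⊤) (h2 : ∫⁻ x, ‖iteratedFDeriv ℝ 2 v x‖ₑ ^ 2 < ⊤)
    (h3 : ∫⁻ x, ‖iteratedFDeriv ℝ 3 v x‖ₑ ^ 2 < ⊤) :
    ∫ x, ⟪P (curl v x), P (W x)⟫ =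
      -ν * (∫ x, frobeniusNormSq (fderiv ℝ (fun y => P (curl v y)) x)) +
        ∫ x, ⟪P (curl v x), P (fderiv ℝ v x (curl v x))⟫ := by
  set e := EuclideanSpace.basisFun (Fin 3) ℝ with he
  have he1 : ∀ i, ‖e i‖ = 1 := fun i => by simp [he]
  have hB0 : 0 ≤ B := (norm_nonneg _).trans (hB 0)
  have hB₁0 : 0 ≤ B₁ := (norm_nonneg _).trans (hB₁ 0)
  set κ : ℝ := ‖P‖ with hκ
  have hκ0 : 0 ≤ κ := norm_nonneg _
  set c : ℝ := ‖curlCLM‖ with hc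
  -- the vorticity, its image `w = P ∘ ω`, and their regularity
  have hω : ContDiff ℝ 2 (curl v) := contDiff_curl (n := 2) (by exact hv)
  have hω1 : ContDiff ℝ 1 (curl v) := hω.of_le (by norm_num)
  set w : (EuclideanSpace ℝ (Fin 3)) → (EuclideanSpace ℝ (Fin 3)) := fun x => P (curl v x) with hwdef
  have hwcomp : w = ⇑P ∘ curl v := rfl
  have hw : ContDiff ℝ 2 w := hω.continuousLinearMap_comp P
  have hw1 : ContDiff ℝ 1 w := hw.of_le (by norm_num)
  have hv1 : ContDiff ℝ 1 v := hv.of_le (by norm_num)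
  have cv : Continuous v := hv.continuous
  have cω : Continuous (curl v) := hω.continuous
  have cw : Continuous w := hw.continuous
  have cDv : Continuous (fderiv ℝ v) := hv.continuous_fderiv (by norm_num)
  have cDω : Continuous (fderiv ℝ (curl v)) := hω.continuous_fderiv (by norm_num)
  have cDw : Continuous (fderiv ℝ w) := hw.continuous_fderiv (by norm_num)
  have hΔ1 : ContDiff ℝ 0 (Δ (curl v)) := contDiff_laplacian (n := 0) (by exact hω)
  have cΔω : Continuous (Δ (curl v)) := hΔ1.continuous
  have cdiw : ∀ i, Continuous fun x => fderiv ℝ w x (e i) := fun i => cDw.clm_apply continuous_const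
  have cddw : ∀ i, Continuous fun x => fderiv ℝ (fun y => fderiv ℝ w y (e i)) x (e i) := fun i =>
    ((((hw.fderiv_right (m := 1) (by norm_num)).clm_apply contDiff_const).continuous_fderiv
      (by norm_num)).clm_apply continuous_const)
  -- `P` commutes with the derivatives
  have hDw : ∀ x, fderiv ℝ w x = P.comp (fderiv ℝ (curl v) x) := fun x =>
    (P.hasFDerivAt.comp x ((hω1.differentiable one_ne_zero) x).hasFDerivAt).fderiv
  have hΔw : ∀ x, (Δ w) x = P ((Δ (curl v)) x) := fun x => by
    rw [hwcomp, ContDiffAt.laplacian_CLM_comp_left hω.contDiffAt]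
    rfl
  have cΔw : Continuous (Δ w) := by
    have : Δ w = fun x => P ((Δ (curl v)) x) := funext hΔw
    rw [this]; exact P.continuous.comp cΔω
  have hconvw : ∀ x, convect v w x = P (convect v (curl v) x) := fun x => by
    rw [convect, convect, hDw]; rfl
  -- pointwise norm bounds
  have n_ω : ∀ x, ‖curl v x‖ ≤ ‖c • iteratedFDeriv ℝ 1 v x‖ := fun x => by
    rw [norm_smul, Real.norm_of_nonneg (norm_nonneg _)]
    have h := norm_iteratedFDeriv_curl_le_opNorm_mul hv 0 (by norm_num) x
    rwa [norm_iteratedFDeriv_zero] at h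
  have n_Dω : ∀ x, ‖fderiv ℝ (curl v) x‖ ≤ ‖c • iteratedFDeriv ℝ 2 v x‖ := fun x => by
    rw [norm_smul, Real.norm_of_nonneg (norm_nonneg _), ← norm_iteratedFDeriv_one]
    exact norm_iteratedFDeriv_curl_le_opNorm_mul hv 1 (by norm_num) x
  have n_D2ω : ∀ x, ‖iteratedFDeriv ℝ 2 (curl v) x‖ ≤ ‖c • iteratedFDeriv ℝ 3 v x‖ := fun x => by
    rw [norm_smul, Real.norm_of_nonneg (norm_nonneg _)]
    exact norm_iteratedFDeriv_curl_le_opNorm_mul hv 2 (by norm_num) x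
  have n_w : ∀ x, ‖w x‖ ≤ ‖κ • (c • iteratedFDeriv ℝ 1 v x)‖ := fun x => by
    rw [norm_smul, Real.norm_of_nonneg hκ0]
    exact (P.le_opNorm _).trans (mul_le_mul_of_nonneg_left (n_ω x) hκ0)
  have n_Dw : ∀ x, ‖fderiv ℝ w x‖ ≤ ‖κ • (c • iteratedFDeriv ℝ 2 v x)‖ := fun x => by
    rw [norm_smul, Real.norm_of_nonneg hκ0, hDw]
    exact (P.opNorm_comp_le _).trans (mul_le_mul_of_nonneg_left (n_Dω x) hκ0)
  have n_D2w : ∀ x, ‖iteratedFDeriv ℝ 2 w x‖ ≤ ‖κ • (c • iteratedFDeriv ℝ 3 v x)‖ := fun x => by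
    rw [norm_smul, Real.norm_of_nonneg hκ0, hwcomp]
    exact (P.norm_iteratedFDeriv_comp_left hω.contDiffAt le_rfl).trans
      (mul_le_mul_of_nonneg_left (n_D2ω x) hκ0)
  have n_Δ : ∀ x, ‖(Δ w) x‖ ≤ ‖(3 : ℝ) • iteratedFDeriv ℝ 2 w x‖ := fun x => by
    rw [norm_smul, Real.norm_of_nonneg (by norm_num : (0 : ℝ) ≤ 3)]
    exact norm_laplacian_le_three_mul_norm_iteratedFDeriv_two hw x
  -- finite `L²` norms
  have l2c1 : ∫⁻ x, ‖c • iteratedFDeriv ℝ 1 v x‖ₑ ^ 2 < ⊤ := lintegral_enorm_sq_const_smul_lt_top _ h1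
  have l2c2 : ∫⁻ x, ‖c • iteratedFDeriv ℝ 2 v x‖ₑ ^ 2 < ⊤ := lintegral_enorm_sq_const_smul_lt_top _ h2
  have l2c3 : ∫⁻ x, ‖c • iteratedFDeriv ℝ 3 v x‖ₑ ^ 2 < ⊤ := lintegral_enorm_sq_const_smul_lt_top _ h3
  have l2ω : ∫⁻ x, ‖curl v x‖ₑ ^ 2 < ⊤ := lintegral_enorm_sq_lt_top_of_norm_le n_ω l2c1
  have l2w : ∫⁻ x, ‖w x‖ₑ ^ 2 < ⊤ :=
    lintegral_enorm_sq_lt_top_of_norm_le n_w (lintegral_enorm_sq_const_smul_lt_top _ l2c1)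
  have l2Dw : ∫⁻ x, ‖fderiv ℝ w x‖ₑ ^ 2 < ⊤ :=
    lintegral_enorm_sq_lt_top_of_norm_le n_Dw (lintegral_enorm_sq_const_smul_lt_top _ l2c2)
  have l2D2w : ∫⁻ x, ‖iteratedFDeriv ℝ 2 w x‖ₑ ^ 2 < ⊤ :=
    lintegral_enorm_sq_lt_top_of_norm_le n_D2w (lintegral_enorm_sq_const_smul_lt_top _ l2c3)
  have l2Δ : ∫⁻ x, ‖(Δ w) x‖ₑ ^ 2 < ⊤ :=
    lintegral_enorm_sq_lt_top_of_norm_le n_Δ (lintegral_enorm_sq_const_smul_lt_top 3 l2D2w)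
  have l2diw : ∀ i, ∫⁻ x, ‖fderiv ℝ w x (e i)‖ₑ ^ 2 < ⊤ := fun i =>
    lintegral_enorm_sq_lt_top_of_norm_le (fun x => by
      simpa [he1] using (fderiv ℝ w x).le_opNorm (e i)) l2Dw
  have l2ddw : ∀ i, ∫⁻ x, ‖fderiv ℝ (fun y => fderiv ℝ w y (e i)) x (e i)‖ₑ ^ 2 < ⊤ := fun i =>
    lintegral_enorm_sq_lt_top_of_norm_le (fun x => norm_fderiv_fderiv_apply_basisFun_le hw x i) l2D2w
  -- the transport and stretching fields (for `w`)
  have cconv : Continuous (convect v w) := cDw.clm_apply cv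
  have cstrP : Continuous fun x => P (convect (curl v) v x) := P.continuous.comp (cDv.clm_apply cω)
  have l2conv : ∫⁻ x, ‖convect v w x‖ₑ ^ 2 < ⊤ := by
    have hb : ∫⁻ x, ‖B * ‖fderiv ℝ w x‖‖ₑ ^ 2 < ⊤ := by
      have h := lintegral_enorm_sq_const_smul_lt_top B
        (lintegral_enorm_sq_lt_top_of_norm_le (fun x => by rw [norm_norm]) l2Dw :
          ∫⁻ x, ‖(‖fderiv ℝ w x‖)‖ₑ ^ 2 < ⊤)
      simpa only [smul_eq_mul] using h
    refine lintegral_enorm_sq_lt_top_of_norm_le (fun x => ?_) hb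
    rw [Real.norm_of_nonneg (by positivity), convect, mul_comm]
    exact (fderiv ℝ w x).le_opNorm_of_le (hB x)
  have l2strP : ∫⁻ x, ‖P (convect (curl v) v x)‖ₑ ^ 2 < ⊤ := by
    have hb : ∫⁻ x, ‖(κ * B₁) * ‖curl v x‖‖ₑ ^ 2 < ⊤ := by
      have h := lintegral_enorm_sq_const_smul_lt_top (κ * B₁)
        (lintegral_enorm_sq_lt_top_of_norm_le (fun x => by rw [norm_norm]) l2ω :
          ∫⁻ x, ‖(‖curl v x‖)‖ₑ ^ 2 < ⊤)
      simpa only [smul_eq_mul] using h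
    refine lintegral_enorm_sq_lt_top_of_norm_le (fun x => ?_) hb
    rw [Real.norm_of_nonneg (by positivity), convect, mul_assoc]
    refine (P.le_opNorm _).trans (mul_le_mul_of_nonneg_left ?_ hκ0)
    exact (fderiv ℝ v x).le_of_opNorm_le_of_le (hB₁ x) le_rfl
  -- integrability of the pairings with `w`
  have c3D2 : Continuous fun x => (3 : ℝ) • iteratedFDeriv ℝ 2 w x :=
    (hw.continuous_iteratedFDeriv le_rfl).const_smul (3 : ℝ)
  have iwΔ : Integrable (fun x => ⟪w x, (Δ w) x⟫) volume :=
    integrable_of_norm_le_mul_of_lintegral_sq (cw.inner cΔw).aestronglyMeasurable cw c3D2 l2w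
      (lintegral_enorm_sq_const_smul_lt_top 3 l2D2w)
      fun x => (norm_inner_le_norm _ _).trans (mul_le_mul_of_nonneg_left (n_Δ x) (norm_nonneg _))
  have iwconv : Integrable (fun x => ⟪w x, convect v w x⟫) volume :=
    integrable_of_norm_le_mul_of_lintegral_sq (cw.inner cconv).aestronglyMeasurable cw cconv l2w
      l2conv fun x => norm_inner_le_norm _ _
  have iwstr : Integrable (fun x => ⟪w x, P (convect (curl v) v x)⟫) volume :=
    integrable_of_norm_le_mul_of_lintegral_sq (cw.inner cstrP).aestronglyMeasurable cw cstrP l2w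
      l2strP fun x => norm_inner_le_norm _ _
  -- (i) diffusion: `∫ ⟪w, Δw⟫ = -∫ |∇w|²_F`
  have ifrob : Integrable (fun x => frobeniusNormSq (fderiv ℝ w x)) volume := by
    have hlt : ∫⁻ x, ENNReal.ofReal (frobeniusNormSq (fderiv ℝ w x)) < ⊤ :=
      calc ∫⁻ x, ENNReal.ofReal (frobeniusNormSq (fderiv ℝ w x))
          ≤ ∫⁻ x, 3 * ‖fderiv ℝ w x‖ₑ ^ 2 :=
            lintegral_mono fun x => ofReal_frobeniusNormSq_le_three_mul_enorm_sq _
        _ = 3 * ∫⁻ x, ‖fderiv ℝ w x‖ₑ ^ 2 := lintegral_const_mul' _ _ (by norm_num)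
        _ < ⊤ := ENNReal.mul_lt_top (by norm_num) l2Dw
    exact integrable_of_continuous_of_nonneg (continuous_frobeniusNormSq_fderiv hw (by simp))
      (fun x => frobeniusNormSq_nonneg _) hlt
  have hlfrob : ∫⁻ x, ENNReal.ofReal (frobeniusNormSq (fderiv ℝ w x)) =
      ENNReal.ofReal (∫ x, frobeniusNormSq (fderiv ℝ w x)) :=
    (ofReal_integral_eq_lintegral_ofReal ifrob
      (Eventually.of_forall fun x => frobeniusNormSq_nonneg _)).symm
  have hdiff : ∫ x, ⟪w x, (Δ w) x⟫ = - ∫ x, frobeniusNormSq (fderiv ℝ w x) := by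
    have i1 : ∀ i, Integrable (fun x => ⟪fderiv ℝ (fun y => fderiv ℝ w y (e i)) x (e i), w x⟫)
        volume := fun i =>
      integrable_of_norm_le_mul_of_lintegral_sq ((cddw i).inner cw).aestronglyMeasurable (cddw i) cw
        (l2ddw i) l2w fun x => norm_inner_le_norm _ _
    have i2 : ∀ i, Integrable (fun x => ⟪fderiv ℝ w x (e i), fderiv ℝ w x (e i)⟫) volume := fun i =>
      integrable_of_norm_le_mul_of_lintegral_sq ((cdiw i).inner (cdiw i)).aestronglyMeasurable
        (cdiw i) (cdiw i) (l2diw i) (l2diw i) fun x => norm_inner_le_norm _ _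
    have i3 : ∀ i, Integrable (fun x => ⟪fderiv ℝ w x (e i), w x⟫) volume := fun i =>
      integrable_of_norm_le_mul_of_lintegral_sq ((cdiw i).inner cw).aestronglyMeasurable (cdiw i) cw
        (l2diw i) l2w fun x => norm_inner_le_norm _ _
    have hG := integral_sum_inner_fderiv_fderiv_eq_neg_integral_inner_laplacian hw hw1 i1 i2 i3
    have hsum : ∫ x, ∑ i, ⟪fderiv ℝ w x (e i), fderiv ℝ w x (e i)⟫ =
        ∫ x, frobeniusNormSq (fderiv ℝ w x) := by
      refine integral_congr_ae (Eventually.of_forall fun x => ?_)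
      simp only
      rw [frobeniusNormSq_eq_sum e]
      exact Finset.sum_congr rfl fun i _ => real_inner_self_eq_norm_sq _
    have hcomm : ∫ x, ⟪w x, (Δ w) x⟫ = ∫ x, ⟪(Δ w) x, w x⟫ :=
      integral_congr_ae (Eventually.of_forall fun x => real_inner_comm _ _)
    rw [hcomm]
    linarith [hG, hsum]
  -- (ii) transport: `∫ ⟪w, (v·∇)w⟫ = 0`
  have hwm : MemLp w 2 volume :=
    ⟨cw.aestronglyMeasurable, eLpNorm_two_lt_top_of_lintegral_enorm_sq_lt_top l2w⟩
  have htrans : ∫ x, ⟪w x, convect v w x⟫ = 0 := by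
    have hwd : IsWeaklyDivFree v := VectorCalculus.IsDivFree.isWeaklyDivFree_holds hdiv hv1
    have hwg : HasWeakGradient w (fderiv ℝ w) := hasWeakGradient_fderiv_of_contDiff hw1
    have hG2 : ∫⁻ x, ENNReal.ofReal (frobeniusNormSq (fderiv ℝ w x)) < ⊤ := by
      rw [hlfrob]; exact ENNReal.ofReal_lt_top
    have hvtop : MemLp v ⊤ volume :=
      memLp_top_of_bound cv.aestronglyMeasurable B (Eventually.of_forall hB)
    have h := integral_inner_weakGrad_apply_self_eq_zero hwd hwg hG2 hwm (q := ⊤) (p := 2)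
      (by norm_num) hvtop hwm
    have hswap : (fun x => ⟪w x, convect v w x⟫) = fun x => ⟪fderiv ℝ w x (v x), w x⟫ :=
      funext fun x => by rw [convect, real_inner_comm]
    rw [hswap]
    exact h
  -- (iii) the identity
  have hWeq : ∀ x, P (W x) = ν • (Δ w) x - convect v w x + P (convect (curl v) v x) := fun x => by
    have h' : W x = convect (curl v) v x + ν • (Δ (curl v)) x - convect v (curl v) x :=
      eq_sub_of_add_eq (heq x)
    rw [h', map_sub, map_add, map_smul, hΔw, hconvw]
    abel
  have hint : ∫ x, ⟪w x, P (W x)⟫ = ν * (∫ x, ⟪w x, (Δ w) x⟫) - (∫ x, ⟪w x, convect v w x⟫) +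
      ∫ x, ⟪w x, P (convect (curl v) v x)⟫ := by
    have h1 : (fun x => ⟪w x, P (W x)⟫) = fun x => ν * ⟪w x, (Δ w) x⟫ - ⟪w x, convect v w x⟫ +
        ⟪w x, P (convect (curl v) v x)⟫ := by
      funext x
      rw [hWeq x, inner_add_right, inner_sub_right, real_inner_smul_right]
    have hI1 : Integrable (fun x => ν * ⟪w x, (Δ w) x⟫ - ⟪w x, convect v w x⟫) volume :=
      (iwΔ.const_mul ν).sub iwconv
    rw [h1, integral_add hI1 iwstr, integral_sub (iwΔ.const_mul ν) iwconv, integral_const_mul]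
  show ∫ x, ⟪w x, P (W x)⟫ = -ν * (∫ x, frobeniusNormSq (fderiv ℝ w x)) +
    ∫ x, ⟪w x, P (fderiv ℝ v x (curl v x))⟫
  rw [hint, hdiff, htrans]
  simp only [convect]
  ring


/-! ### The slab Grönwall bound for `∫|Pω|²` with an integrable weight and the enstrophy as forcing -/

set_option maxHeartbeats 1600000 in
/-- **The `L²` bound for a linear image of the vorticity on a closed slab** (the Grönwall step of
Chae–Choe 1999, proof of Thm. 2: from (12)–(13),
"`d/dt‖ω̃‖²₂ + ν‖∇ω̃‖²₂ ≤ C‖ω‖²₂ + C‖∇ṽ‖_γ^{2γ/(γ−3)}‖ω̃‖²₂`. Using the Gronwall lemma similarly to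
the proof of Theorem 1, we obtain `sup ‖ω̃‖²₂ + ν∫‖∇ω̃‖²₂ ≤ C(‖ω̃₀‖₂, ‖∇ṽ‖_{L^{α,γ}_T})`").
Let `(u, p)` be a classical unforced Navier–Stokes solution on the closed slab `[0, T''] × ℝ³`,
`ν > 0`, with all `L²` Sobolev seminorms bounded there, `ω = curl u(t)`, and let
`P : ℝ³ →L ℝ³` be a constant linear map. Let `a ≥ 0` be a weight with `∫₀^{T''} a ≤ A` (lower
integral), `β ≥ 0`, and `∫₀^{T''} ∫|ω|² ≤ E₁` (lower integral in time). If for a.e.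
`t ∈ (0, T'')`
`2∫⟪Pω, P((∇u)ω)⟫ ≤ ν ∫|∇(Pω)|²_F + β ∫|ω|² + a(t) ∫|Pω|²`,
then `∫|Pω(t)|² ≤ (∫|Pω(0)|² + β E₁) · exp A` for all `t ∈ [0, T'']` (only the `sup_t` half of the
printed conclusion: the dissipation half `ν∫₀^{T''}∫|∇(Pω)|²_F` is not part of the conclusion here;
referee F58.1). Proof: the smooth
space–time field `Pω` has time derivative `P∂ₜω` and satisfies the `L²` balance
(`IsSmoothSpaceTimeOn.l2_balance`); the fixed-time identity
`integral_inner_clm_curl_eq_of_vorticity_eq`; Grönwall in lower-integral form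
(`lintegral_gronwall_le`). [cite: ChaeChoe1999, proof of Thm. 2, (12)–(13) and the Grönwall step (pp. 5–6)] -/
theorem integral_sq_norm_clm_curl_le_of_weight_slab_ae {ν T'' : ℝ} (hν : 0 < ν) (hT'' : 0 < T'')
    {u : ℝ → (EuclideanSpace ℝ (Fin 3)) → (EuclideanSpace ℝ (Fin 3))} {p : ℝ → (EuclideanSpace ℝ (Fin 3)) → ℝ}
    (hS : IsClassicalNSSolutionOn (Icc 0 T'') ν 0 u p)
    (hB : HasBoundedSobolevNormsOn (Icc 0 T'') u)
    (P : EuclideanSpace ℝ (Fin 3) →L[ℝ] EuclideanSpace ℝ (Fin 3))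
    {a : ℝ → ℝ} (ha0 : ∀ t, 0 ≤ a t)
    {A : ℝ} (hA0 : 0 ≤ A) (hA : ∫⁻ t in Ioo 0 T'', ENNReal.ofReal (a t) ≤ ENNReal.ofReal A)
    {β : ℝ} (hβ : 0 ≤ β) {E₁ : ℝ} (hE₁0 : 0 ≤ E₁)
    (hE₁ : ∫⁻ t in Ioo 0 T'', ENNReal.ofReal (∫ x, ‖curl (u t) x‖ ^ 2) ≤ ENNReal.ofReal E₁)
    (hstr : ∀ᵐ t ∂(volume.restrict (Ioo 0 T'')),
      2 * ∫ x, ⟪P (curl (u t) x), P (fderiv ℝ (u t) x (curl (u t) x))⟫ ≤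
        ν * (∫ x, frobeniusNormSq (fderiv ℝ (fun y => P (curl (u t) y)) x)) +
          β * (∫ x, ‖curl (u t) x‖ ^ 2) + a t * (∫ x, ‖P (curl (u t) x)‖ ^ 2)) :
    ∀ t ∈ Icc 0 T'', ∫ x, ‖P (curl (u t) x)‖ ^ 2 ≤
      ((∫ x, ‖P (curl (u 0) x)‖ ^ 2) + β * E₁) * Real.exp A := by
  have hU : UniqueDiffOn ℝ (Icc 0 T'') := uniqueDiffOn_Icc hT''
  have h0S : (0 : ℝ) ∈ Icc 0 T'' := ⟨le_rfl, hT''.le⟩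
  set c : ℝ := ‖curlCLM‖ with hc
  set κ : ℝ := ‖P‖ with hκ
  have hκ0 : 0 ≤ κ := norm_nonneg _
  -- smoothness of the slices
  have hsm : ∀ t ∈ Icc 0 T'', ContDiff ℝ ∞ (u t) := fun t ht => hS.contDiff_velocity ht
  have hsm4 : ∀ t ∈ Icc 0 T'', ContDiff ℝ 4 (u t) := fun t ht => (hsm t ht).of_le (by norm_cast)
  have hsm3 : ∀ t ∈ Icc 0 T'', ContDiff ℝ 3 (u t) := fun t ht => (hsm t ht).of_le (by norm_cast)
  have hsm2 : ∀ t ∈ Icc 0 T'', ContDiff ℝ 2 (u t) := fun t ht => (hsm t ht).of_le (by norm_cast)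
  -- sup bounds
  obtain ⟨B₀, hB₀⟩ := linfty_bound_of_hasBoundedSobolevNormsOn_holds hsm2 hB
  obtain ⟨B₁, hB₁0, hB₁⟩ := exists_forall_norm_fderiv_le_of_hasBoundedSobolevNormsOn hsm3 hB
  have hB₀0 : 0 ≤ B₀ := (norm_nonneg _).trans (hB₀ 0 h0S 0)
  -- the Sobolev bounds
  have hfin : ∀ n, ∀ t ∈ Icc 0 T'', ∫⁻ x, ‖iteratedFDeriv ℝ n (u t) x‖ₑ ^ 2 < ⊤ := fun n t ht => by
    obtain ⟨C, hC⟩ := hB n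
    exact (hC t ht).trans_lt ENNReal.coe_lt_top
  choose Cn hCn using hB
  -- the vorticity field, its image under `P`, and their time derivatives
  set vort : ℝ → (EuclideanSpace ℝ (Fin 3)) → (EuclideanSpace ℝ (Fin 3)) := vorticity u with hωdef
  have hωt : ∀ t, vort t = curl (u t) := fun t => rfl
  have hωsm : IsSmoothSpaceTimeOn (Icc 0 T'') vort :=
    (hS.smooth_velocity.fderiv_slice hU).clm_comp curlCLM
  set W : ℝ → (EuclideanSpace ℝ (Fin 3)) → (EuclideanSpace ℝ (Fin 3)) := timeDerivWithin (Icc 0 T'') vort with hWdef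
  have hvort : ∀ t ∈ Icc 0 T'', ∀ x,
      W t x + convect (u t) (vort t) x = convect (vort t) (u t) x + ν • (Δ (vort t)) x := fun t ht x =>
    (hS.isVorticitySolutionOn_of_uniqueDiffOn hU (fun s _ y => curl_zero y)).vorticity_eq t ht x
  set wt : ℝ → (EuclideanSpace ℝ (Fin 3)) → (EuclideanSpace ℝ (Fin 3)) := fun t x => P (vort t x) with hwtdef
  have hwtsm : IsSmoothSpaceTimeOn (Icc 0 T'') wt := hωsm.clm_comp P
  set Wt : ℝ → (EuclideanSpace ℝ (Fin 3)) → (EuclideanSpace ℝ (Fin 3)) := timeDerivWithin (Icc 0 T'') wt with hWtdef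
  have hWt : ∀ t ∈ Icc 0 T'', ∀ x, Wt t x = P (W t x) := by
    intro t ht x
    have hd : HasDerivWithinAt (fun s => vort s x) (W t x) (Icc 0 T'') t :=
      hωsm.hasDerivWithinAt_timeDerivWithin hU ht x
    have hcomp := (P.hasFDerivAt.comp_hasDerivWithinAt t hd).derivWithin (hU t ht)
    rw [hWtdef, timeDerivWithin_apply]
    exact hcomp
  -- `L²` bounds for the vorticity and its time derivative (as in `EnstrophyWeightSlab`)
  set V₀ : ℝ≥0∞ := ENNReal.ofReal (c ^ 2) * (Cn 1 : ℝ≥0∞) with hV₀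
  have hV₀top : V₀ < ⊤ := ENNReal.mul_lt_top ENNReal.ofReal_lt_top ENNReal.coe_lt_top
  have hωL2 : ∀ t ∈ Icc 0 T'', ∫⁻ x, ‖vort t x‖ₑ ^ 2 ≤ V₀ := fun t ht =>
    (lintegral_curl_sq_le (u t)).trans (mul_le_mul' le_rfl (hCn 1 t ht))
  set V₁ : ℝ≥0∞ := 3 * (ENNReal.ofReal ((ν * (3 * c)) ^ 2) * (Cn 3 : ℝ≥0∞) +
    ENNReal.ofReal ((B₀ * c) ^ 2) * (Cn 2 : ℝ≥0∞) + ENNReal.ofReal ((B₁ * c) ^ 2) * (Cn 1 : ℝ≥0∞))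
    with hV₁
  have hV₁top : V₁ < ⊤ := by
    refine ENNReal.mul_lt_top (by norm_num) ?_
    refine ENNReal.add_lt_top.2 ⟨ENNReal.add_lt_top.2 ⟨?_, ?_⟩, ?_⟩ <;>
      exact ENNReal.mul_lt_top ENNReal.ofReal_lt_top ENNReal.coe_lt_top
  have hWL2 : ∀ t ∈ Icc 0 T'', ∫⁻ x, ‖W t x‖ₑ ^ 2 ≤ V₁ := by
    intro t ht
    have hv := hsm3 t ht
    have hpt : ∀ x, ‖W t x‖ ≤ (ν * (3 * c)) * ‖iteratedFDeriv ℝ 3 (u t) x‖ +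
        (B₀ * c) * ‖iteratedFDeriv ℝ 2 (u t) x‖ + (B₁ * c) * ‖iteratedFDeriv ℝ 1 (u t) x‖ := by
      intro x
      have hw2 : ContDiff ℝ 2 (curl (u t)) := contDiff_curl (n := 2) (by exact hv)
      have heq : W t x = ν • (Δ (vort t)) x - convect (u t) (vort t) x + convect (vort t) (u t) x := by
        have h := hvort t ht x
        have : W t x = convect (vort t) (u t) x + ν • (Δ (vort t)) x - convect (u t) (vort t) x :=
          eq_sub_of_add_eq h
        rw [this]; abel
      rw [heq, hωt]
      have t1 : ‖ν • (Δ (curl (u t))) x‖ ≤ (ν * (3 * c)) * ‖iteratedFDeriv ℝ 3 (u t) x‖ := by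
        rw [norm_smul, Real.norm_of_nonneg hν.le, mul_assoc, mul_assoc]
        refine mul_le_mul_of_nonneg_left ?_ hν.le
        calc ‖(Δ (curl (u t))) x‖ ≤ 3 * ‖iteratedFDeriv ℝ 2 (curl (u t)) x‖ :=
              norm_laplacian_le_three_mul_norm_iteratedFDeriv_two hw2 x
          _ ≤ 3 * (c * ‖iteratedFDeriv ℝ 3 (u t) x‖) :=
              mul_le_mul_of_nonneg_left (norm_iteratedFDeriv_curl_le_opNorm_mul hv 2 (by norm_num) x) (by norm_num)
      have t2 : ‖convect (u t) (curl (u t)) x‖ ≤ (B₀ * c) * ‖iteratedFDeriv ℝ 2 (u t) x‖ := by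
        rw [convect]
        calc ‖fderiv ℝ (curl (u t)) x (u t x)‖ ≤ ‖fderiv ℝ (curl (u t)) x‖ * ‖u t x‖ :=
              ContinuousLinearMap.le_opNorm _ _
          _ ≤ (c * ‖iteratedFDeriv ℝ 2 (u t) x‖) * B₀ := by
              refine mul_le_mul ?_ (hB₀ t ht x) (norm_nonneg _) (by positivity)
              rw [← norm_iteratedFDeriv_one]
              exact norm_iteratedFDeriv_curl_le_opNorm_mul hv 1 (by norm_num) x
          _ = (B₀ * c) * ‖iteratedFDeriv ℝ 2 (u t) x‖ := by ring
      have t3 : ‖convect (curl (u t)) (u t) x‖ ≤ (B₁ * c) * ‖iteratedFDeriv ℝ 1 (u t) x‖ := by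
        rw [convect]
        calc ‖fderiv ℝ (u t) x (curl (u t) x)‖ ≤ ‖fderiv ℝ (u t) x‖ * ‖curl (u t) x‖ :=
              ContinuousLinearMap.le_opNorm _ _
          _ ≤ B₁ * (c * ‖iteratedFDeriv ℝ 1 (u t) x‖) := by
              refine mul_le_mul (hB₁ t ht x) ?_ (norm_nonneg _) hB₁0
              have h := norm_iteratedFDeriv_curl_le_opNorm_mul hv 0 (by norm_num) x
              rwa [norm_iteratedFDeriv_zero] at h
          _ = (B₁ * c) * ‖iteratedFDeriv ℝ 1 (u t) x‖ := by ring
      have e1 : ‖ν • (Δ (curl (u t))) x - convect (u t) (curl (u t)) x + convect (curl (u t)) (u t) x‖ ≤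
          ‖ν • (Δ (curl (u t))) x - convect (u t) (curl (u t)) x‖ + ‖convect (curl (u t)) (u t) x‖ :=
        norm_add_le _ _
      have e2 : ‖ν • (Δ (curl (u t))) x - convect (u t) (curl (u t)) x‖ ≤
          ‖ν • (Δ (curl (u t))) x‖ + ‖convect (u t) (curl (u t)) x‖ := norm_sub_le _ _
      linarith [e1, e2, t1, t2, t3]
    refine (lintegral_enorm_sq_le_of_norm_le_three ((hv.continuous_iteratedFDeriv le_rfl))
      (hv.continuous_iteratedFDeriv (by norm_num)) (hv.continuous_iteratedFDeriv (by norm_num))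
      (by positivity) (by positivity) (by positivity) hpt).trans ?_
    rw [hV₁]
    exact mul_le_mul' le_rfl (add_le_add (add_le_add (mul_le_mul' le_rfl (hCn 3 t ht))
      (mul_le_mul' le_rfl (hCn 2 t ht))) (mul_le_mul' le_rfl (hCn 1 t ht)))
  -- `L²` bounds for `Pω` and `P∂ₜω`
  have hPsq : ∀ (F : (EuclideanSpace ℝ (Fin 3)) → (EuclideanSpace ℝ (Fin 3))),
      ∫⁻ x, ‖P (F x)‖ₑ ^ 2 ≤ ‖P‖ₑ ^ 2 * ∫⁻ x, ‖F x‖ₑ ^ 2 := by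
    intro F
    rw [← lintegral_const_mul' _ _ (by simp)]
    refine lintegral_mono fun x => ?_
    rw [← mul_pow]
    gcongr
    exact P.le_opENorm _
  set U₀ : ℝ≥0∞ := ‖P‖ₑ ^ 2 * V₀ with hU₀
  set U₁ : ℝ≥0∞ := ‖P‖ₑ ^ 2 * V₁ with hU₁
  have hU₀top : U₀ < ⊤ := ENNReal.mul_lt_top (by simp) hV₀top
  have hU₁top : U₁ < ⊤ := ENNReal.mul_lt_top (by simp) hV₁top
  have hwtL2 : ∀ t ∈ Icc 0 T'', ∫⁻ x, ‖wt t x‖ₑ ^ 2 ≤ U₀ := fun t ht =>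
    (hPsq (vort t)).trans (mul_le_mul' le_rfl (hωL2 t ht))
  have hWtL2 : ∀ t ∈ Icc 0 T'', ∫⁻ x, ‖Wt t x‖ₑ ^ 2 ≤ U₁ := by
    intro t ht
    calc ∫⁻ x, ‖Wt t x‖ₑ ^ 2 = ∫⁻ x, ‖P (W t x)‖ₑ ^ 2 := lintegral_congr fun x => by rw [hWt t ht x]
      _ ≤ ‖P‖ₑ ^ 2 * ∫⁻ x, ‖W t x‖ₑ ^ 2 := hPsq (W t)
      _ ≤ U₁ := mul_le_mul' le_rfl (hWL2 t ht)
  -- the balance of `∫|Pω|²`, and the continuity of `∫|ω|²`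
  obtain ⟨-, -, hbal⟩ := hwtsm.l2_balance hT'' (C₀ := U₀.toNNReal) (C₁ := U₁.toNNReal)
    (fun t ht => by rw [ENNReal.coe_toNNReal hU₀top.ne]; exact hwtL2 t ht)
    (fun t ht => by rw [ENNReal.coe_toNNReal hU₁top.ne]; exact hWtL2 t ht)
  obtain ⟨-, hZcont, -⟩ := hωsm.l2_balance hT'' (C₀ := V₀.toNNReal) (C₁ := V₁.toNNReal)
    (fun t ht => by rw [ENNReal.coe_toNNReal hV₀top.ne]; exact hωL2 t ht)
    (fun t ht => by rw [ENNReal.coe_toNNReal hV₁top.ne]; exact hWL2 t ht)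
  -- the quantities
  set Y : ℝ → ℝ := fun t => ∫ x, ‖wt t x‖ ^ 2 with hYdef
  set Z : ℝ → ℝ := fun t => ∫ x, ‖vort t x‖ ^ 2 with hZdef
  set Φ : ℝ → ℝ := fun t => ∫ x, 2 * ⟪wt t x, Wt t x⟫ with hΦdef
  have hY0 : ∀ t, 0 ≤ Y t := fun t => integral_nonneg fun x => sq_nonneg _
  have hZ0 : ∀ t, 0 ≤ Z t := fun t => integral_nonneg fun x => sq_nonneg _
  have hYU : ∀ t ∈ Icc 0 T'', ENNReal.ofReal (Y t) ≤ U₀ := by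
    intro t ht
    have hi : Integrable fun x => ‖wt t x‖ ^ 2 := by
      refine integrable_sq_norm_of_lintegral_lt_top (hwtsm.contDiff_slice ht).continuous ?_
      exact (hwtL2 t ht).trans_lt hU₀top
    rw [hYdef]
    show ENNReal.ofReal (∫ x, ‖wt t x‖ ^ 2) ≤ U₀
    rw [ofReal_integral_eq_lintegral_ofReal hi (Eventually.of_forall fun x => sq_nonneg _)]
    refine le_trans (le_of_eq (lintegral_congr fun x => ?_)) (hwtL2 t ht)
    rw [← ofReal_norm, ENNReal.ofReal_pow (norm_nonneg _)]
  -- the slice inequality `Φ t ≤ β Z t + a t * Y t` at a.e. time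
  have hslice : ∀ᵐ t ∂volume, t ∈ Ioo 0 T'' → Φ t ≤ β * Z t + a t * Y t := by
    have h' := (ae_restrict_iff' measurableSet_Ioo).1 hstr
    filter_upwards [h'] with t ht htI
    have htS : t ∈ Icc 0 T'' := ⟨htI.1.le, htI.2.le⟩
    have hv := hsm3 t htS
    have hid := integral_inner_clm_curl_eq_of_vorticity_eq P hv (hS.divFree t htS) (hvort t htS)
      (hB₀ t htS) (hB₁ t htS) (hfin 1 t htS) (hfin 2 t htS) (hfin 3 t htS)
    have hst := ht htI
    have hDnn : 0 ≤ ∫ x, frobeniusNormSq (fderiv ℝ (fun y => P (curl (u t) y)) x) :=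
      integral_nonneg fun x => frobeniusNormSq_nonneg _
    have hΦt : Φ t = 2 * ∫ x, ⟪wt t x, Wt t x⟫ := by
      rw [hΦdef]
      exact integral_const_mul _ _
    have hΦt' : Φ t = 2 * ∫ x, ⟪P (curl (u t) x), P (W t x)⟫ := by
      rw [hΦt]
      congr 1
      exact integral_congr_ae (Eventually.of_forall fun x => by
        show ⟪P (vort t x), Wt t x⟫ = ⟪P (curl (u t) x), P (W t x)⟫
        rw [hWt t htS x, hωt])
    rw [hΦt', hid]
    have hYt : Y t = ∫ x, ‖P (curl (u t) x)‖ ^ 2 := rfl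
    have hZt : Z t = ∫ x, ‖curl (u t) x‖ ^ 2 := rfl
    rw [hYt, hZt]
    nlinarith [hst, hν, hDnn, ha0 t, hβ, hZ0 t]
  -- measurability of the forcing `t ↦ β Z t` on `(0, T'')`
  have hZm : AEMeasurable (fun t => ENNReal.ofReal (β * Z t)) (volume.restrict (Ioo 0 T'')) := by
    have hc : ContinuousOn Z (Ioo 0 T'') := hZcont.mono Ioo_subset_Icc_self
    have hm : AEMeasurable Z (volume.restrict (Ioo 0 T'')) :=
      (hc.aestronglyMeasurable measurableSet_Ioo).aemeasurable
    exact ENNReal.measurable_ofReal.comp_aemeasurable (hm.const_mul β)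
  -- Grönwall, lower-integral form
  set φ : ℝ → ℝ≥0∞ := fun t => ENNReal.ofReal (Y t) with hφdef
  set aE : ℝ → ℝ≥0∞ := fun t => ENNReal.ofReal (a t) with haEdef
  set Bg : ℝ≥0∞ := ENNReal.ofReal (Y 0) + ENNReal.ofReal β * ENNReal.ofReal E₁ with hBg
  have hineq : ∀ b ∈ Icc 0 T'', φ b ≤ Bg + ∫⁻ s in Ioo 0 b, aE s * φ s := by
    intro b hb
    rcases eq_or_lt_of_le hb.1 with h0 | hb0
    · rw [← h0]
      simp only [Ioo_self, Measure.restrict_empty, lintegral_zero_measure, add_zero]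
      rw [hφdef, hBg]
      exact le_self_add
    have hbalb := hbal b ⟨hb0, hb.2⟩
    -- `Y b = Y 0 + ∫₀ᵇ Φ`
    have hYb : Y b = Y 0 + ∫ t in Ioo 0 b, Φ t := by
      have h : (∫ x, ‖wt b x‖ ^ 2) = (∫ x, ‖wt 0 x‖ ^ 2) + ∫ t in (0 : ℝ)..b, Φ t := hbalb
      rw [intervalIntegral.integral_of_le hb0.le, integral_Ioc_eq_integral_Ioo] at h
      exact h
    -- pointwise bound on `(0, b)`, a.e.
    have hpt : ∀ᵐ t ∂volume, t ∈ Ioo 0 b → ENNReal.ofReal (Φ t) ≤ ENNReal.ofReal (β * Z t) + aE t * φ t := by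
      filter_upwards [hslice] with t ht htb
      have htT : t ∈ Ioo 0 T'' := ⟨htb.1, htb.2.trans_le hb.2⟩
      rw [haEdef, hφdef, ← ENNReal.ofReal_mul (ha0 t), ← ENNReal.ofReal_add (mul_nonneg hβ (hZ0 t))
        (mul_nonneg (ha0 t) (hY0 t))]
      exact ENNReal.ofReal_le_ofReal (ht htT)
    -- the forcing integral
    have hforce : ∫⁻ t in Ioo 0 b, ENNReal.ofReal (β * Z t) ≤ ENNReal.ofReal β * ENNReal.ofReal E₁ := by
      calc ∫⁻ t in Ioo 0 b, ENNReal.ofReal (β * Z t)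
          ≤ ∫⁻ t in Ioo 0 T'', ENNReal.ofReal (β * Z t) := lintegral_mono_set (Ioo_subset_Ioo le_rfl hb.2)
        _ = ∫⁻ t in Ioo 0 T'', ENNReal.ofReal β * ENNReal.ofReal (Z t) :=
            lintegral_congr fun t => ENNReal.ofReal_mul hβ
        _ = ENNReal.ofReal β * ∫⁻ t in Ioo 0 T'', ENNReal.ofReal (Z t) :=
            lintegral_const_mul' _ _ ENNReal.ofReal_ne_top
        _ ≤ ENNReal.ofReal β * ENNReal.ofReal E₁ := mul_le_mul' le_rfl hE₁
    have hZm' : AEMeasurable (fun t => ENNReal.ofReal (β * Z t)) (volume.restrict (Ioo 0 b)) :=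
      hZm.mono_measure (Measure.restrict_mono (Ioo_subset_Ioo le_rfl hb.2) le_rfl)
    calc φ b = ENNReal.ofReal (Y 0 + ∫ t in Ioo 0 b, Φ t) := by
          show ENNReal.ofReal (Y b) = _
          rw [hYb]
      _ ≤ ENNReal.ofReal (Y 0) + ENNReal.ofReal (∫ t in Ioo 0 b, Φ t) := ENNReal.ofReal_add_le
      _ ≤ ENNReal.ofReal (Y 0) + ∫⁻ t in Ioo 0 b, ENNReal.ofReal (Φ t) :=
          add_le_add le_rfl (ofReal_integral_le_lintegral_ofReal_tc _)
      _ ≤ ENNReal.ofReal (Y 0) + ∫⁻ t in Ioo 0 b, (ENNReal.ofReal (β * Z t) + aE t * φ t) :=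
          add_le_add le_rfl (setLIntegral_mono_ae' measurableSet_Ioo hpt)
      _ = ENNReal.ofReal (Y 0) + ((∫⁻ t in Ioo 0 b, ENNReal.ofReal (β * Z t)) +
            ∫⁻ t in Ioo 0 b, aE t * φ t) := by rw [lintegral_add_left' hZm']
      _ ≤ ENNReal.ofReal (Y 0) + (ENNReal.ofReal β * ENNReal.ofReal E₁ + ∫⁻ t in Ioo 0 b, aE t * φ t) :=
          add_le_add le_rfl (add_le_add hforce le_rfl)
      _ = Bg + ∫⁻ s in Ioo 0 b, aE s * φ s := by rw [hBg, add_assoc]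
  -- hypotheses of Grönwall
  have hBgtop : Bg ≠ ⊤ := ENNReal.add_ne_top.2 ⟨ENNReal.ofReal_ne_top,
    ENNReal.mul_ne_top ENNReal.ofReal_ne_top ENNReal.ofReal_ne_top⟩
  have hφM : ∀ t ∈ Icc 0 T'', φ t ≤ U₀ := fun t ht => hYU t ht
  have hatop : ∫⁻ t in Ioo 0 T'', aE t ≠ ⊤ :=
    ne_top_of_le_ne_top ENNReal.ofReal_ne_top hA
  have hgron := lintegral_gronwall_le hBgtop hU₀top.ne hφM hatop hineq
  -- the exponent
  have hexp : ∀ t ∈ Icc 0 T'', (∫⁻ s in Ioo 0 t, aE s).toReal ≤ A := by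
    intro t ht
    have h1 : ∫⁻ s in Ioo 0 t, aE s ≤ ∫⁻ s in Ioo 0 T'', aE s :=
      lintegral_mono_set (Ioo_subset_Ioo le_rfl ht.2)
    have h4 := h1.trans hA
    have := ENNReal.toReal_mono ENNReal.ofReal_ne_top h4
    rwa [ENNReal.toReal_ofReal hA0] at this
  have hBgR : Bg = ENNReal.ofReal (Y 0 + β * E₁) := by
    rw [hBg, ← ENNReal.ofReal_mul hβ, ← ENNReal.ofReal_add (hY0 0) (mul_nonneg hβ hE₁0)]
  -- conclusion
  intro t ht
  have hg := hgron t ht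
  have hY00 : 0 ≤ Y 0 + β * E₁ := add_nonneg (hY0 0) (mul_nonneg hβ hE₁0)
  have hfinal : φ t ≤ ENNReal.ofReal ((Y 0 + β * E₁) * Real.exp A) := by
    refine hg.trans ?_
    rw [hBgR, ← ENNReal.ofReal_mul hY00]
    refine ENNReal.ofReal_le_ofReal (mul_le_mul_of_nonneg_left ?_ hY00)
    exact Real.exp_le_exp.2 (hexp t ht)
  have := (ENNReal.ofReal_le_ofReal_iff (mul_nonneg hY00 (Real.exp_pos _).le)).1 hfinal
  exact this

end Literature.Analysis.FluidPDE
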